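import Mathlib
import HarnessLib
import Summits.ResolutionOfSingularities.ResolutionOfSingularities.Theorems.WildQuotientsWildQuotientResolutionS1aNodeAway
import Summits.ResolutionOfSingularities.ResolutionOfSingularities.Theorems.WildQuotientsWildQuotientResolutionS1aCoarseChart

/-!
# S1a — CENTRES LOCALISE (ring level): the K1′ σ-adapted homogeneous weighted centre `(f, w)` of a node `(B, 𝒜, σ)` read in the
# localised node `(B[h⁻¹], locPiece, σ_h)` — regular sequence, regular quotient, weighted and trace filtrations, Veronese degree

[OURS · L1 W4.5c · lead-1 g8; infrastructure for `PrincipalCentreChartShrink` (support form) / `KillableAtOfIdle` / (A3)] — NOT statements of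
the manuscript; counted 0; AI-level work, weaker than expert review. Crux stmt-ResolutionOfSingularities-17941, line `s1a-logminvertex` v6.
Pure commutative algebra, route-independent.

* `map_weightedFiltration_ideal` — `φ(𝒥ₙ(u, w)) · A' = 𝒥ₙ(φ ∘ u, w)` for any ring hom `φ` (spans of weighted monomials);
* `isRegular_ofFn_map` — a regular sequence stays regular in a localisation in which it does not generate the unit ideal
  (`IsWeaklyRegular.of_isLocalization` + the non-triviality clause of Mathlib's `IsRegular`);
  `isRegularRing_quotient_span_map` — `B ⧸ (f)` regular ⇒ `B[h⁻¹] ⧸ (f)` regular (`isRegularRing_of_isLocalization`);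
* `map_sigmaAway_weightedFiltration_le` — σ-adaptedness passes to `σ_h`;
* `zeroToAwayZero 𝒜 hh : 𝒜 0 →+* (B[h⁻¹])₀` and **`traceFiltration_away`**: the degree-`0` trace of the weighted filtration of `B[h⁻¹]` is the
  extension of the trace of `B`; `veroneseNormalised_away` — Veronese degrees persist;
* `exists_pow_mem_traceFiltration_of_map_eq_top` — if `(f) · B[h⁻¹] = ⊤` then `h^N ∈ K_d` for some `N` (the algebra behind «a point of the
  support of `𝒦.ideal d` in `D(b)` forces `(f) · B[h⁻¹] ≠ ⊤`»).
-/

set_option linter.dupNamespace false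

noncomputable section

open DirectSum Literature.AlgebraicGeometry.Resolution RingTheory.Sequence
open Summit.ResolutionOfSingularities.ResolutionOfSingularities.Theorems.WildQuotientResolution.S1.GradedLocalization
open Summit.ResolutionOfSingularities.ResolutionOfSingularities.Theorems.WildQuotientResolution.S1.NodeAway
open Summit.ResolutionOfSingularities.ResolutionOfSingularities.Theorems.WildQuotientResolution.S1.CoarseChart

namespace Summit.ResolutionOfSingularities.ResolutionOfSingularities.Theorems.WildQuotientResolution.S1.CentreAway

universe u v

/-! ## Weighted filtrations under ring homs -/

section Weighted

variable {A A' : Type*} [CommRing A] [CommRing A'] (φ : A →+* A') {κ : Type*} (u : κ → A) (w : κ → ℕ)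

/-- The image of the weighted monomials of `(u, w)` is the set of weighted monomials of `(φ ∘ u, w)`. -/
theorem image_weightedMonomials (n : ℕ) : φ '' weightedMonomials u w n = weightedMonomials (φ ∘ u) w n := by
  ext m
  constructor
  · rintro ⟨_, ⟨α, hα, rfl⟩, rfl⟩
    refine ⟨α, hα, ?_⟩
    rw [map_finsuppProd]
    simp only [map_pow, Function.comp_apply]
  · rintro ⟨α, hα, rfl⟩
    refine ⟨α.prod fun i e => u i ^ e, ⟨α, hα, rfl⟩, ?_⟩
    rw [map_finsuppProd]
    simp only [map_pow, Function.comp_apply]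

/-- **`φ(𝒥ₙ(u,w)) · A' = 𝒥ₙ(φ ∘ u, w)`**: weighted filtrations are spans of weighted monomials. [OURS · L1 W4.5c] -/
theorem map_weightedFiltration_ideal (n : ℕ) :
    ((weightedFiltration u w).ideal n).map φ = (weightedFiltration (φ ∘ u) w).ideal n := by
  rw [weightedFiltration_ideal, weightedFiltration_ideal, Ideal.map_span, image_weightedMonomials]

/-- `(u) ≤ 𝒥₁` when all weights are positive. -/
theorem span_range_le_weightedFiltration_one (hw : ∀ i, 0 < w i) :
    Ideal.span (Set.range u) ≤ (weightedFiltration u w).ideal 1 := by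
  rw [Ideal.span_le]
  rintro _ ⟨i, rfl⟩
  exact (weightedFiltration u w).antitone (hw i) (mem_weightedFiltration_ideal u w i)

end Weighted

/-! ## Regular sequences and regular quotients in a localisation -/

section Regular

variable {B : Type u} [CommRing B] (S : Type u) [CommRing S] [Algebra B S] (M : Submonoid B) [IsLocalization M S]
  {c : ℕ} (f : Fin c → B)

/-- `Ideal.ofList (List.ofFn f) = Ideal.span (range f)`. -/
theorem ofList_ofFn (g : Fin c → S) : Ideal.ofList (List.ofFn g) = Ideal.span (Set.range g) := by
  change Ideal.span {r | r ∈ List.ofFn g} = _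
  congr 1
  ext r
  simp only [Set.mem_setOf_eq, List.mem_ofFn', Set.mem_range]

omit [Algebra B S] in
/-- `span (range (φ ∘ f)) = φ(span (range f)) · S`. -/
theorem span_range_comp (φ : B →+* S) : Ideal.span (Set.range (φ ∘ f)) = (Ideal.span (Set.range f)).map φ := by
  rw [Ideal.map_span, Set.range_comp]

include M in
/-- **A regular sequence stays regular in a localisation in which it does not generate the unit ideal.** [OURS · L1 W4.5c] -/
theorem isRegular_ofFn_map (hK1 : IsRegular B (List.ofFn f)) (hne : (Ideal.span (Set.range f)).map (algebraMap B S) ≠ ⊤) :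
    IsRegular S (List.ofFn (algebraMap B S ∘ f)) := by
  have hmap : List.ofFn (algebraMap B S ∘ f) = (List.ofFn f).map (algebraMap B S) := by rw [List.map_ofFn]
  refine ⟨?_, ?_⟩
  · rw [hmap]; exact hK1.toIsWeaklyRegular.of_isLocalization S M
  · rw [ofList_ofFn, span_range_comp, smul_eq_mul, Ideal.mul_top]
    exact fun h => hne h.symm

include M in
/-- **`B ⧸ (f)` regular ⇒ `S ⧸ (f)·S` regular** for a localisation `S` of `B`. [OURS · L1 W4.5c] -/
theorem isRegularRing_quotient_span_map [IsRegularRing (B ⧸ Ideal.span (Set.range f))] :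
    IsRegularRing (S ⧸ Ideal.span (Set.range (algebraMap B S ∘ f))) := by
  rw [span_range_comp]
  exact isRegularRing_of_isLocalization (Algebra.algebraMapSubmonoid (B ⧸ Ideal.span (Set.range f)) M) _

end Regular

/-! ## In the localised node `B[h⁻¹]` -/

section Away

variable {ι : Type v} [AddCommGroup ι] [DecidableEq ι] {B : Type u} [CommRing B] (𝒜 : ι → AddSubgroup B) [GradedRing 𝒜]
  {h : B} (hh : h ∈ 𝒜 0) {c : ℕ} (f : Fin c → B) (w : Fin c → ℕ)

/-- σ-adaptedness passes to `σ_h`: `σ_h(𝒥ₙ · B[h⁻¹]) ≤ 𝒥ₙ · B[h⁻¹]`. [OURS · L1 W4.5c] -/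
theorem map_sigmaAway_weightedFiltration_le (σ : B ≃+* B) (hσh : σ h = h)
    (hσJ : ∀ n : ℕ, ((weightedFiltration f w).ideal n).map (σ : B →+* B) ≤ (weightedFiltration f w).ideal n) (n : ℕ) :
    ((weightedFiltration (algebraMap B (Localization.Away h) ∘ f) w).ideal n).map
        (sigmaAway σ hσh : Localization.Away h →+* Localization.Away h) ≤
      (weightedFiltration (algebraMap B (Localization.Away h) ∘ f) w).ideal n := by
  rw [← map_weightedFiltration_ideal, Ideal.map_map]
  have hcomp : (sigmaAway σ hσh : Localization.Away h →+* Localization.Away h).comp (algebraMap B (Localization.Away h)) =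
      (algebraMap B (Localization.Away h)).comp (σ : B →+* B) :=
    RingHom.ext fun x => sigmaAway_algebraMap σ hσh x
  rw [hcomp, ← Ideal.map_map]
  exact Ideal.map_mono (hσJ n)

/-- The structure map `𝒜 0 → (B[h⁻¹])₀`. [OURS · L1 W4.5c] -/
def zeroToAwayZero : letI := locGradedRing 𝒜 hh; ↥(𝒜 0) →+* ↥(locPiece 𝒜 hh 0) :=
  letI := locGradedRing 𝒜 hh
  ((algebraMap B (Localization.Away h)).comp (SetLike.GradeZero.subring 𝒜).subtype).codRestrict
    (SetLike.GradeZero.subring (locPiece 𝒜 hh)) fun x => algebraMap_mem_locPiece 𝒜 hh x.2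

/-- Pin: `zeroToAwayZero x = x / 1`. -/
theorem coe_zeroToAwayZero (x : ↥(𝒜 0)) :
    letI := locGradedRing 𝒜 hh
    ((zeroToAwayZero 𝒜 hh x : ↥(locPiece 𝒜 hh 0)) : Localization.Away h) = algebraMap B (Localization.Away h) (x : B) :=
  rfl

/-- `h⁻¹` as an element of `(B[h⁻¹])₀`. -/
def invSelfZero : letI := locGradedRing 𝒜 hh; ↥(locPiece 𝒜 hh 0) :=
  ⟨IsLocalization.Away.invSelf h, invSelf_mem_locPiece_zero 𝒜 hh⟩

/-- Pin: `invSelfZero = h⁻¹`. -/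
theorem coe_invSelfZero : letI := locGradedRing 𝒜 hh; ((invSelfZero 𝒜 hh : ↥(locPiece 𝒜 hh 0)) : Localization.Away h) =
    IsLocalization.Away.invSelf h := rfl

/-- Every element of `(B[h⁻¹])₀` is `(x/1) · (h⁻¹)ᵐ` with `x ∈ 𝒜 0`. -/
theorem exists_eq_zeroToAwayZero_mul (z : letI := locGradedRing 𝒜 hh; ↥(locPiece 𝒜 hh 0)) :
    letI := locGradedRing 𝒜 hh
    ∃ (m : ℕ) (x : ↥(𝒜 0)), z = zeroToAwayZero 𝒜 hh x * invSelfZero 𝒜 hh ^ m := by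
  letI := locGradedRing 𝒜 hh
  obtain ⟨m, x, hx, hz⟩ := (mem_locPiece_zero_iff 𝒜 hh).mp z.2
  exact ⟨m, ⟨x, hx⟩, Subtype.ext hz⟩

/-- **The degree-`0` trace localises**: `K_n(B[h⁻¹]) = K_n(B) · (B[h⁻¹])₀`. [OURS · L1 W4.5c] -/
theorem traceFiltration_away (n : ℕ) :
    letI := locGradedRing 𝒜 hh
    (traceFiltration (locPiece 𝒜 hh) (algebraMap B (Localization.Away h) ∘ f) w).ideal n =
      ((traceFiltration 𝒜 f w).ideal n).map (zeroToAwayZero 𝒜 hh) := by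
  letI := locGradedRing 𝒜 hh
  apply le_antisymm
  · intro z hz
    rw [mem_traceFiltration_iff, ← map_weightedFiltration_ideal] at hz
    -- `z = x/hᵐ`, `x ∈ 𝒜 0`, and `z ∈ 𝒥ₙ B[h⁻¹]`
    obtain ⟨m, x, rfl⟩ := exists_eq_zeroToAwayZero_mul 𝒜 hh z
    obtain ⟨⟨⟨j, hj⟩, ⟨_, s, rfl⟩⟩, hjs⟩ := (IsLocalization.mem_map_algebraMap_iff (Submonoid.powers h) (Localization.Away h)).mp hz
    -- clear denominators: `x h^s = j hᵐ` up to `h`-torsion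
    have h1 : algebraMap B (Localization.Away h) ((x : B) * h ^ s) = algebraMap B (Localization.Away h) (j * h ^ m) := by
      have hu : algebraMap B (Localization.Away h) (h ^ m) * IsLocalization.Away.invSelf h ^ m = 1 := by
        rw [map_pow, ← mul_pow, IsLocalization.Away.mul_invSelf, one_pow]
      have e1 : algebraMap B (Localization.Away h) ((x : B) * h ^ s) =
          (algebraMap B _ (x : B) * IsLocalization.Away.invSelf h ^ m * algebraMap B _ (h ^ s)) * algebraMap B _ (h ^ m) := by
        rw [map_mul]
        linear_combination (-(algebraMap B (Localization.Away h) (x : B) * algebraMap B _ (h ^ s))) * hu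
      rw [e1]
      change ((zeroToAwayZero 𝒜 hh x * invSelfZero 𝒜 hh ^ m : ↥(locPiece 𝒜 hh 0)) : Localization.Away h) * _ * _ = _
      rw [hjs, map_mul]
    obtain ⟨⟨_, t, rfl⟩, ht⟩ := IsLocalization.exists_of_eq (M := Submonoid.powers h) h1
    change h ^ t * ((x : B) * h ^ s) = h ^ t * (j * h ^ m) at ht
    -- the numerator `y = x h^{s+t} ∈ K_n`
    have hy0 : (x : B) * h ^ (s + t) ∈ 𝒜 0 := by
      have := SetLike.mul_mem_graded x.2 (SetLike.pow_mem_graded (s + t) hh)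
      rwa [nsmul_zero, add_zero] at this
    have hyJ : (x : B) * h ^ (s + t) ∈ (weightedFiltration f w).ideal n := by
      have : (x : B) * h ^ (s + t) = h ^ t * ((x : B) * h ^ s) := by ring
      rw [this, ht]
      exact Ideal.mul_mem_left _ _ (Ideal.mul_mem_right _ _ hj)
    have hy : (⟨_, hy0⟩ : ↥(𝒜 0)) ∈ (traceFiltration 𝒜 f w).ideal n := hyJ
    -- and `z = y/1 · (h⁻¹)^{m+s+t}`
    have hz' : zeroToAwayZero 𝒜 hh x * invSelfZero 𝒜 hh ^ m =
        zeroToAwayZero 𝒜 hh ⟨_, hy0⟩ * invSelfZero 𝒜 hh ^ (m + (s + t)) := by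
      apply Subtype.ext
      change algebraMap B (Localization.Away h) (x : B) * IsLocalization.Away.invSelf h ^ m =
        algebraMap B (Localization.Away h) ((x : B) * h ^ (s + t)) * IsLocalization.Away.invSelf h ^ (m + (s + t))
      exact algebraMap_mul_invSelf_pow_eq (x : B) m (s + t)
    rw [hz']
    exact Ideal.mul_mem_right _ _ (Ideal.mem_map_of_mem _ hy)
  · rw [Ideal.map_le_iff_le_comap]
    intro x hx
    rw [Ideal.mem_comap, mem_traceFiltration_iff, ← map_weightedFiltration_ideal]
    exact Ideal.mem_map_of_mem _ hx

/-- **Veronese degrees persist in the localised node.** [OURS · L1 W4.5c] -/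
theorem veroneseNormalised_away {d : ℕ} (hver : VeroneseNormalised 𝒜 f w d) :
    @VeroneseNormalised ι _ _ (Localization.Away h) _ (locPiece 𝒜 hh) (locGradedRing 𝒜 hh) c
      (algebraMap B (Localization.Away h) ∘ f) w d := by
  letI := locGradedRing 𝒜 hh
  refine ⟨hver.1, fun l => ?_⟩
  rw [traceFiltration_away, traceFiltration_away, hver.2 l, Ideal.map_pow]

/-- The centre elements are homogeneous in the localised grading. -/
theorem algebraMap_comp_mem_locPiece {δ : Fin c → ι} (hf : ∀ i, f i ∈ 𝒜 (δ i)) (i : Fin c) :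
    (algebraMap B (Localization.Away h) ∘ f) i ∈ locPiece 𝒜 hh (δ i) :=
  algebraMap_mem_locPiece 𝒜 hh (hf i)

/-- **If `(f) · B[h⁻¹] = ⊤` then a power of `h` lies in `K_d`** (all weights positive). [OURS · L1 W4.5c] -/
theorem exists_pow_mem_traceFiltration_of_map_eq_top (hw : ∀ i, 0 < w i) (d : ℕ)
    (H : (Ideal.span (Set.range f)).map (algebraMap B (Localization.Away h)) = ⊤) :
    ∃ N : ℕ, (⟨h, hh⟩ : ↥(𝒜 0)) ^ N ∈ (traceFiltration 𝒜 f w).ideal d := by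
  have h1 : (1 : Localization.Away h) ∈ (Ideal.span (Set.range f)).map (algebraMap B (Localization.Away h)) := by
    rw [H]; trivial
  obtain ⟨⟨⟨j, hj⟩, ⟨_, k, rfl⟩⟩, hjk⟩ := (IsLocalization.mem_map_algebraMap_iff (Submonoid.powers h) (Localization.Away h)).mp h1
  rw [one_mul] at hjk
  obtain ⟨⟨_, t, rfl⟩, ht⟩ := IsLocalization.exists_of_eq (M := Submonoid.powers h) hjk
  change h ^ t * h ^ k = h ^ t * j at ht
  have hmem : h ^ (t + k) ∈ (weightedFiltration f w).ideal 1 := by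
    rw [pow_add, ht]
    exact Ideal.mul_mem_left _ _ (span_range_le_weightedFiltration_one f w hw hj)
  have htr : (⟨h, hh⟩ : ↥(𝒜 0)) ^ (t + k) ∈ (traceFiltration 𝒜 f w).ideal 1 := by
    rw [mem_traceFiltration_iff, SetLike.GradeZero.coe_pow]
    exact hmem
  refine ⟨(t + k) * d, ?_⟩
  rw [pow_mul]
  have := pow_le_traceFiltration 𝒜 f w 1 d (Ideal.pow_mem_pow htr d)
  rwa [one_mul] at this

end Away

end Summit.ResolutionOfSingularities.ResolutionOfSingularities.Theorems.WildQuotientResolution.S1.CentreAway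

end
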